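import Summits.AtomisticToContinuum.HydrodynamicLimit.Theorems.CollisionIsometryCLTCollisionalTransferLocalityBlockFields
import Literature.MathematicalPhysics.KineticTheory.HardSphereUniformDensityLLN
import HarnessLib

/-!
# [CeilR] A block-density ceiling forces a mollified-density ceiling
(stub `stub_mollDensity_le_of_blockCeiling`, line `hemisphere-affine-slaving`, crux
`CollisionalTransferLocality`, stmt-AtomisticToContinuum-9518)

Supporting file (`--supports stmt-AtomisticToContinuum-9518`) of the line lead, proving the registered
stub [CeilR] `stub_mollDensity_le_of_blockCeiling` VERBATIM: there is an absolute constant `c` (here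
`c = 32`) such that for every admissible kernel family `φ` at mesoscale `ℓ = (N+1)^{-γ}`, every radius
`ℓ ≤ r < 1/4`, every `M ≥ 0` and every configuration `w` of `N + 1` spheres whose block density
`ρ̄ = rhoB φ N w` is `≤ M` EVERYWHERE on `𝕋³`, the cone-mollified empirical density obeys
`ρ_r(w, x) ≤ M (1 + c ℓ / r)` at every `x ∈ 𝕋³`.

## Proof (deterministic geometry on the torus)

Fix `x` and write `K(y) = b_r(y, x)` for the cone kernel (`3/(π r⁴)`-Lipschitz for the minimal-image
distance, `abs_coneKernel_sub_le`; total mass one for `r < 1/2`, `integral_coneKernel`) and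
`φᵢ(y) = φ_N(xᵢ − y)` (mass one by translation / reflection invariance of Haar measure; supported in
`d(xᵢ, y) < ℓ`).  Pointwise in `y`,
`φᵢ(y) K(xᵢ) ≤ φᵢ(y) · (K(y) + (3ℓ/(π r⁴)) 𝟙{d(y, x) < 2r})`:
if `d(xᵢ, x) ≥ r` the left side vanishes; otherwise, on the support of `φᵢ`, the Lipschitz bound gives
`K(xᵢ) ≤ K(y) + 3ℓ/(π r⁴)` and `d(y, x) < ℓ + r ≤ 2r`.  Integrating in `y` and averaging over `i`,
`ρ_r(w, x) ≤ ∫ ρ̄(y) (K(y) + (3ℓ/(π r⁴)) 𝟙_{B(x,2r)}(y)) dy ≤ M (1 + (3ℓ/(π r⁴)) (4π/3) (2r)³) = M (1 + 32 ℓ / r)`,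
the Haar volume of the minimal-image ball of radius `2r < 1/2` being the Euclidean one
(`Torus.volume_euclidDist_lt`, `EuclideanSpace.volume_ball_fin_three`).

No new definitions, no named facts; axioms `propext`, `Classical.choice`, `Quot.sound`.
-/

namespace Summit.AtomisticToContinuum.HydrodynamicLimit.Theorems.HemisphereAffineSlaving

open scoped BigOperators Topology Classical ENNReal InnerProductSpace
open Filter Set Function MeasureTheory

noncomputable section

open Literature.MathematicalPhysics.KineticTheory (T3 V3)
open Literature.MathematicalPhysics.KineticTheory Literature.Analysis.FluidPDE

/-! ## Elementary facts on the cone kernel and minimal-image balls -/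

/-- The cone kernel is symmetric in its two points (the minimal-image distance is). -/
private theorem cr_coneKernel_comm (r : ℝ) (x y : T3) : coneKernel r x y = coneKernel r y x := by
  unfold coneKernel
  rw [Torus.euclidDist_comm]

/-- The cone kernel `b_r(y, x)` vanishes once `d(y, x) ≥ r` (`r > 0`). -/
private theorem cr_coneKernel_eq_zero_of_le {r : ℝ} (hr : 0 < r) {y x : T3}
    (h : r ≤ Torus.euclidDist y x) : coneKernel r y x = 0 := by
  unfold coneKernel
  rw [max_eq_right (by rw [sub_nonpos, le_div_iff₀ hr, one_mul]; exact h), mul_zero]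

/-- One-sided Lipschitz bound of the cone kernel in its first point:
`b_r(y', x) ≤ b_r(y, x) + (3/(π r⁴)) d(y', y)`. -/
private theorem cr_coneKernel_le_add {r : ℝ} (hr : 0 < r) (x y y' : T3) :
    coneKernel r y' x ≤ coneKernel r y x + 3 / (Real.pi * r ^ 4) * Torus.euclidDist y' y := by
  have h := (abs_sub_le_iff.1 (abs_coneKernel_sub_le hr x y' y)).1
  rw [cr_coneKernel_comm r x y', cr_coneKernel_comm r x y] at h
  linarith

/-- The cone kernel is continuous in its first point. -/
private theorem cr_continuous_coneKernel_left (r : ℝ) (x : T3) :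
    Continuous fun y : T3 => coneKernel r y x := by
  have h : Continuous fun y : T3 => Torus.euclidDist y x := by
    simp only [euclidDist_eq_sqrt]
    fun_prop
  unfold coneKernel
  fun_prop

/-- `d(a − y, 0) = d(a, y)` for the minimal-image distance. -/
private theorem cr_euclidDist_sub_zero (a y : T3) :
    Torus.euclidDist (a - y) 0 = Torus.euclidDist a y := by
  rw [Torus.euclidDist_eq, Torus.euclidDist_eq, sub_zero]

/-- Minimal-image balls are measurable. -/
private theorem cr_measurableSet_ball (s : ℝ) (x : T3) :
    MeasurableSet {y : T3 | Torus.euclidDist y x < s} := by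
  have h : Measurable fun y : T3 => Torus.euclidDist y x := by
    simp only [Torus.euclidDist_eq]
    exact (Torus.measurable_reprSym.comp (measurable_id.sub_const x)).norm
  exact measurableSet_lt h measurable_const

/-- The Haar volume of a minimal-image ball of radius `0 ≤ s < 1/2` is `(4π/3) s³`. -/
private theorem cr_volume_real_ball {s : ℝ} (hs0 : 0 ≤ s) (hs : s < 1 / 2) (x : T3) :
    (volume : Measure T3).real {y : T3 | Torus.euclidDist y x < s} = 4 / 3 * Real.pi * s ^ 3 := by
  rw [measureReal_def, Torus.volume_euclidDist_lt hs x, EuclideanSpace.volume_ball_fin_three,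
    ← ENNReal.ofReal_pow hs0, ← ENNReal.ofReal_mul (by positivity),
    ENNReal.toReal_ofReal (by positivity)]
  ring

/-! ## The registered stub -/

/-- **[CeilR] A BLOCK-DENSITY CEILING FORCES A MOLLIFIED-DENSITY CEILING** (registered stub
`stub_mollDensity_le_of_blockCeiling` of the line `hemisphere-affine-slaving`, crux
`CollisionalTransferLocality`): with the absolute constant `c = 32`, for every admissible kernel family
`φ` at mesoscale `ℓ = (N+1)^{-γ} ≤ r < 1/4` and every configuration `w` whose block density
`rhoB φ N w` is bounded by `M ≥ 0` everywhere, `ρ_r(w, x) ≤ M (1 + c ℓ / r)` everywhere.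
Proof: the cone kernel is `3/(π r⁴)`-Lipschitz, so spreading each particle over the unit mass
`φ_N(xᵢ − ·)` (supported in `d < ℓ`) costs at most `3ℓ/(π r⁴)` per particle within distance `r` of
`x`; the spread sum is `∫ ρ̄ b_r(·, x) ≤ M` (mass one of the cone kernel), and the number of particles
within `r` of `x`, over `N + 1`, is at most `∫_{B(x, 2r)} ρ̄ ≤ M (4π/3)(2r)³`. -/
theorem stub_mollDensity_le_of_blockCeiling : ∃ c : ℝ, 0 ≤ c ∧ ∀ (γ C : ℝ) (φ : ℕ → T3 → ℝ), 0 < γ → AdmissibleKernel γ C φ → ∀ (r : ℝ), 0 < r → r < 1 / 4 → ∀ (N : ℕ), ((N : ℝ) + 1) ^ (-γ) ≤ r → ∀ (M : ℝ), 0 ≤ M → ∀ (w : Cfg N), (∀ x : T3, rhoB φ N w x ≤ M) → ∀ x : T3, Literature.MathematicalPhysics.KineticTheory.mollDensity r w x ≤ M * (1 + c * ((N : ℝ) + 1) ^ (-γ) / r) := by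
  refine ⟨32, by norm_num, ?_⟩
  intro γ C φ hγ hφ r hr hr4 N hℓr M hM w hρM x
  -- admissibility, unpacked at rank `N`
  have hφc : Continuous (φ N) := (hφ.1 N).continuous
  have hφ0 : ∀ y, 0 ≤ φ N y := hφ.2.1 N
  have hφ1 : ∫ y, φ N y = 1 := hφ.2.2.1 N
  have hφs : ∀ y, ((N : ℝ) + 1) ^ (-γ) ≤ Torus.euclidDist y 0 → φ N y = 0 := hφ.2.2.2.1 N
  have hφb : ∀ y, φ N y ≤ C * ((N : ℝ) + 1) ^ (3 * γ) := hφ.2.2.2.2.1 N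
  set ℓ : ℝ := ((N : ℝ) + 1) ^ (-γ) with hℓ
  have hℓ0 : 0 ≤ ℓ := Real.rpow_nonneg (by positivity) _
  have hr2 : r < 1 / 2 := by linarith
  have hL0 : 0 ≤ 3 / (Real.pi * r ^ 4) := by positivity
  have hBm : MeasurableSet {y : T3 | Torus.euclidDist y x < 2 * r} := cr_measurableSet_ball (2 * r) x
  have hK0 : ∀ y : T3, 0 ≤ coneKernel r y x := fun y => (coneKernel_mem_Icc hr y x).1
  have hKi : Integrable (fun y : T3 => coneKernel r y x) :=
    (cr_continuous_coneKernel_left r x).integrable_unitAddTorus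
  have hIi : Integrable ({y : T3 | Torus.euclidDist y x < 2 * r}.indicator
      fun _ => 3 / (Real.pi * r ^ 4) * ℓ) := (integrable_const _).indicator hBm
  -- the comparison function `g = b_r(·, x) + (3ℓ/(π r⁴)) 𝟙_{B(x, 2r)}`
  obtain ⟨g, hg⟩ : ∃ g : T3 → ℝ, g = fun y => coneKernel r y x +
      {y : T3 | Torus.euclidDist y x < 2 * r}.indicator (fun _ => 3 / (Real.pi * r ^ 4) * ℓ) y :=
    ⟨_, rfl⟩
  have hg0 : ∀ y, 0 ≤ g y := fun y => by
    rw [hg]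
    exact add_nonneg (hK0 y) (Set.indicator_nonneg (fun _ _ => mul_nonneg hL0 hℓ0) y)
  have hgi : Integrable g := by
    rw [hg]
    exact hKi.add hIi
  have hintg : ∫ y, g y = 1 + 32 * ℓ / r := by
    have hsplit : ∫ y, g y = (∫ y : T3, coneKernel r y x) +
        ∫ y, {y : T3 | Torus.euclidDist y x < 2 * r}.indicator
          (fun _ => 3 / (Real.pi * r ^ 4) * ℓ) y := by
      rw [hg]
      exact integral_add hKi hIi
    rw [hsplit, integral_coneKernel hr hr2 x, integral_indicator_const _ hBm,
      cr_volume_real_ball (by positivity) (by linarith) x, smul_eq_mul]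
    field_simp
    ring
  -- the pointwise comparison, particle by particle
  have hpt : ∀ (i : Fin (N + 1)) (y : T3),
      φ N ((w i).1 - y) * coneKernel r (w i).1 x ≤ φ N ((w i).1 - y) * g y := by
    intro i y
    by_cases h0 : φ N ((w i).1 - y) = 0
    · rw [h0, zero_mul, zero_mul]
    refine mul_le_mul_of_nonneg_left ?_ (hφ0 _)
    have hdy : Torus.euclidDist (w i).1 y < ℓ := by
      by_contra hle
      exact h0 (hφs _ (by rw [cr_euclidDist_sub_zero]; exact not_lt.1 hle))
    by_cases hix : Torus.euclidDist (w i).1 x < r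
    · have hyB : y ∈ {y : T3 | Torus.euclidDist y x < 2 * r} := by
        have h1 := euclidDist_triangle' y (w i).1 x
        have h2 := Torus.euclidDist_comm y (w i).1
        show Torus.euclidDist y x < 2 * r
        linarith
      have hLip : coneKernel r (w i).1 x ≤ coneKernel r y x + 3 / (Real.pi * r ^ 4) * ℓ :=
        (cr_coneKernel_le_add hr x y (w i).1).trans
          (add_le_add le_rfl (mul_le_mul_of_nonneg_left hdy.le hL0))
      rw [hg]
      show coneKernel r (w i).1 x ≤ coneKernel r y x +
        {y : T3 | Torus.euclidDist y x < 2 * r}.indicator (fun _ => 3 / (Real.pi * r ^ 4) * ℓ) y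
      rw [indicator_of_mem hyB]
      exact hLip
    · rw [cr_coneKernel_eq_zero_of_le hr (not_lt.1 hix)]
      exact hg0 y
  -- integrate in `y`: `b_r(xᵢ, x) ≤ ∫ φ_N(xᵢ − y) g(y) dy`
  haveI : (volume : Measure T3).IsNegInvariant := Measure.IsAddHaarMeasure.isNegInvariant_of_regular _
  have hφi_int : ∀ i : Fin (N + 1), Integrable (fun y : T3 => φ N ((w i).1 - y)) := fun i =>
    hφc.integrable_unitAddTorus.comp_sub_left (w i).1
  have hφi_one : ∀ i : Fin (N + 1), ∫ y, φ N ((w i).1 - y) = 1 := fun i => by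
    rw [integral_sub_left_eq_self (φ N) volume (w i).1]
    exact hφ1
  have hφg_int : ∀ i : Fin (N + 1), Integrable (fun y : T3 => φ N ((w i).1 - y) * g y) := by
    intro i
    refine hgi.bdd_mul (hφi_int i).aestronglyMeasurable (c := C * ((N : ℝ) + 1) ^ (3 * γ))
      (Eventually.of_forall fun y => ?_)
    rw [Real.norm_eq_abs, abs_of_nonneg (hφ0 _)]
    exact hφb _
  have hKle : ∀ i : Fin (N + 1), coneKernel r (w i).1 x ≤ ∫ y, φ N ((w i).1 - y) * g y := by
    intro i
    calc coneKernel r (w i).1 x = ∫ y, φ N ((w i).1 - y) * coneKernel r (w i).1 x := by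
          rw [integral_mul_const, hφi_one i, one_mul]
      _ ≤ ∫ y, φ N ((w i).1 - y) * g y :=
          integral_mono ((hφi_int i).mul_const _) (hφg_int i) (hpt i)
  -- average over the particles and compare with the ceiling
  have hmoll : mollDensity r w x = ((N + 1 : ℕ) : ℝ)⁻¹ * ∑ i, coneKernel r (w i).1 x := by
    unfold mollDensity
    rw [integral_empiricalMeasure]
  calc mollDensity r w x = ((N + 1 : ℕ) : ℝ)⁻¹ * ∑ i, coneKernel r (w i).1 x := hmoll
    _ ≤ ((N + 1 : ℕ) : ℝ)⁻¹ * ∑ i, ∫ y, φ N ((w i).1 - y) * g y :=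
        mul_le_mul_of_nonneg_left (Finset.sum_le_sum fun i _ => hKle i) (by positivity)
    _ = ∫ y, ((N + 1 : ℕ) : ℝ)⁻¹ * ∑ i, φ N ((w i).1 - y) * g y := by
        rw [integral_const_mul, integral_finsetSum _ fun i _ => hφg_int i]
    _ = ∫ y, rhoB φ N w y * g y := by
        refine integral_congr_ae (Eventually.of_forall fun y => ?_)
        simp only [rhoB_eq, Finset.sum_mul, Finset.mul_sum, mul_assoc]
    _ ≤ ∫ y, M * g y := by
        refine integral_mono_of_nonneg
          (Eventually.of_forall fun y => mul_nonneg (rhoB_nonneg hφ0) (hg0 y)) (hgi.const_mul M)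
          (Eventually.of_forall fun y => ?_)
        exact mul_le_mul_of_nonneg_right (hρM y) (hg0 y)
    _ = M * (1 + 32 * ℓ / r) := by rw [integral_const_mul, hintg]

end

end Summit.AtomisticToContinuum.HydrodynamicLimit.Theorems.HemisphereAffineSlaving
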